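import Summits.HodgeConjecture.HodgeConjecture.Theorems.K2E5QuatAdelicCoordinates      -- ★ (p16): `quatCoordEquiv`, `quatCoordInv`, `quatBasisAdele`, `skewElt`, `realPart`
import Literature.NumberTheory.Automorphic.MatrixAdeleModule                            -- ★ `addHaar_matrix_smul_eq` (`vol(g Z) = |det g|_𝔸ⁿ vol Z` on `M_n(𝔸_K)`)
import HarnessLib

/-!
# K2 ∕ E5 «TamagawaUnitary», unit G «ZETA» — G3-support ED. 2 `K2E5QuatPoissonDilation`: the MODULE of `y ↦ x·y` on `D_{h,𝔸}` is `|det x|_{𝔸_L} = quatModule x`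

Cell `hodgecm-mathlib` (Track B «K2-LIT»), item h413 = `stmt-HodgeConjecture-24833`; dealt BY NAME by K2E5-plan (g0), DEALS E5 BATCH #8 (h)
(2026-09-03T23:12:18Z: «… with the module of `x ↦ a·x` = ★ `quatModule`»), to base K2E5-p14; author K2E5-p14 (g0).  PROOF lane (theorems only,
`--supports stmt-HodgeConjecture-24833 --as helper`); companion of ★ `K2E5QuatPoissonTransport` (ED. 1, p855575: Poisson on `D_h ⊂ D_{h,𝔸}`).  The heads
are quoted BY NAME by the unit-G socket G3 `Zeta.sig_K2E5QuatZetaResidue` (Tate's unfolding: `∫ Φ(x y) dy = |x|⁻¹ ∫ Φ`, `(Φ(x ·))^(z) = |x|⁻¹ Φ̂(z x⁻¹)`).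

Setting (★ #3g `K2E5QuatZetaDefs`, ★ `K2E5QuatAdelicCoordinates`, ★ #3d `K2E5QuatAdelicMatrixModelDefs`): `L` CM, `L⁺ = maximalRealSubfield L`, `𝔸⁺`, `𝔸_L`,
`V = M₂(𝔸_L)`, `D_{h,𝔸} = quatAdelic L Ha ⊂ V`, `(D_h ⊗ 𝔸)^× = quatAdelicUnits L Ha ≤ GL₂(𝔸_L)`, `e = quatBasis`, coordinates `quatCoord L e : 𝔸⁺⁴ → V`
(a topological isomorphism onto `D_{h,𝔸}` with inverse ★ `quatCoordInv`), the module ★ `quatModule L Ha x = |det x|_{𝔸_L}` (`adelicAbsDet 2 L`).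
For a unit `x`, LEFT MULTIPLICATION BY `x` READ IN COORDINATES is the map `T_x : 𝔸⁺⁴ → 𝔸⁺⁴`, `T_x a = quatCoordInv (x · quatCoord e a)` (so that
`quatCoord e (T_x a) = x · quatCoord e a`, `quatCoord_dilate`); it is written out in every statement (no definition is introduced).

Content (theorems; any additive Haar measure `ν4` on `𝔸⁺⁴`, e.g. G3's `Measure.pi fun _ => ν`):
* §1 `quatCoord_dilate`, `dilate_inv_dilate`, `dilate_dilate_inv`, `continuous_dilate` — `T_x` is a homeomorphism with inverse `T_{x⁻¹}`.
* §2 **`measure_image_dilate`** — THE MODULE: `ν4 (T_x '' S) = |det x|_{𝔸_L} · ν4 S` for EVERY set `S ⊆ 𝔸⁺⁴`.  PROOF («doubling», no regular-representation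
  determinant): the map `Θ(a, b) = ∑ᵢ Ψ(aᵢ, bᵢ) (eᵢ ⊗ 1) = quatCoord e a + μ · quatCoord e b` (★ `quadraticAdeleEquiv Ψ : 𝔸⁺ × 𝔸⁺ ≃ 𝔸_L`, `μ = skewElt L ⊗ 1`,
  ★ `quatBasisAdele`) is a homeomorphism `𝔸⁺⁴ × 𝔸⁺⁴ ≃ V = M₂(𝔸_L)`, additive and EQUIVARIANT: `x · Θ(a, b) = Θ(T_x a, T_x b)` (`μ` is a scalar).  Hence
  `λ_V := Θ_*(ν4 ⊗ ν4)` is an additive Haar measure on `V`, and ★ `addHaar_matrix_smul_eq` (Weil: the module of `X ↦ g X` on `M_n(𝔸)` is `|det g|ⁿ`, `n = 2`)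
  gives `ν4(T_x A) · ν4(T_x A') = |det x|² · ν4(A) · ν4(A')` for all `A, A'`; with `A = A'` a positive compact this forces `ν4(T_x A') = |det x| · ν4(A')`,
  and then the general identity.
* §3 `map_dilate_eq_smul` — `(T_x)_* ν4 = |det x|⁻¹ • ν4`; **`integral_quatCoord_mul_left`** — for every `Φ : V → E`:
  `∫ Φ(x · quatCoord e a) dν4(a) = |det x|_{𝔸_L}⁻¹ • ∫ Φ(quatCoord e a) dν4(a)` (no measurability hypothesis: `T_x` is a measurable equivalence).

What is deliberately NOT here (next edition): the Schwartz–Bruhat stability `Φ ∈ 𝒮(D_{h,𝔸}) ⇒ Φ(x ·) ∈ 𝒮(D_{h,𝔸})` (needs `GL₄(𝔸⁺)`-stability of ★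
`piSchwartzBruhat`, in the tree only for coordinate permutations and matrix twists), and the right-multiplication twin (same proof with ★ `addHaar_matrix_op_smul_eq`).

HONEST LABEL: HC_CM is proved only modulo the 7 printed citations (2 remaining named inputs: hLiu418 = stmt-HodgeConjecture-24832,
h413 = stmt-HodgeConjecture-24833) until rung 0 closes; this file is a support lemma for socket G3 of ONE tier-1 unit and discharges no socket by itself.

AUDIT (materialised pages; `book:vignerasnd-arithmetique-des-algebres-de-quaternions` = V80): V80 p0053.txt:L22 «où x¹ (ou x₁) désigne le noyau de la norme réduite (ou du
module) dans x»; V80 p0062.txt (Ch. III §2, proof of Thm. 2.2: `Z_X(Φ, s) = ∫_{X_A^•} Φ(x) ‖x‖^s dx*`, change of variables `y ↦ x y` of module `‖x‖`).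

## References
* [VignerasLNM800] M.-F. Vignéras, *Arithmétique des algèbres de quaternions*, LNM 800 (1980) — Ch. II §4, Ch. III §1–§2 (the module `‖x‖_X = |N(x)|`, `N = n²`).
* [WeilBNT1967] A. Weil, *Basic Number Theory* (1967) — Ch. I §2 (modules of automorphisms), Ch. IV §3 Prop. 3 and Cor. 1 (module of `X ↦ gX` on `M_n(𝔸)`).
* [CasselsFrohlichANT1967] J. Tate, Ch. XV §4.1 (Lemma 4.1.2: the module of an idèle).
-/

set_option autoImplicit false
set_option linter.dupNamespace false

noncomputable section

namespace Summit.HodgeConjecture.HodgeConjecture.Cruxes.H413.K2E5QuatPoissonDilation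

open MeasureTheory Measure NumberField IsDedekindDomain
open Literature.NumberTheory.Automorphic
open Summit.HodgeConjecture.HodgeConjecture.Cruxes.H413.K2E5QuatAdelicMatrixModel
open Summit.HodgeConjecture.HodgeConjecture.Cruxes.H413.K2E5QuatZeta
open Summit.HodgeConjecture.HodgeConjecture.Cruxes.H413.K2E5QuatAdelicCoordinates
open scoped Matrix MatrixGroups NNReal ENNReal Pointwise

variable (L : Type) [Field L] [NumberField L] [IsCMField L] {Ha : Matrix (Fin 2) (Fin 2) L}

/-! ## §1 Left multiplication by a unit, read in the coordinates `𝔸⁺⁴` -/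

/-- A unit of `(D_h ⊗ 𝔸)^×` has its matrix in `D_{h,𝔸}` (★ `mem_quatAdelicUnits_iff`). [cite: VignerasLNM800, Ch. III §1 (unités X_A^×)] -/
theorem coe_coe_mem_quatAdelic (x : ↥(quatAdelicUnits L Ha)) :
    ((x : GL (Fin 2) (AdeleRing (𝓞 L) L)) : Matrix (Fin 2) (Fin 2) (AdeleRing (𝓞 L) L)) ∈ quatAdelic L Ha :=
  (mem_quatAdelicUnits_iff L Ha _).1 x.2

/-- **`quatCoord e (T_x a) = x · quatCoord e a`**: left multiplication by a unit `x ∈ (D_h ⊗ 𝔸)^×` preserves `D_{h,𝔸}`, so its conjugate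
`T_x = quatCoordInv ∘ (x · ) ∘ quatCoord e` by the coordinate isomorphism is a genuine lift (★ `quatCoord_quatCoordInv`). [cite: VignerasLNM800, Ch. III §1] -/
theorem quatCoord_dilate (hHa : (Ha.map (cmConjRingHom L)).transpose = Ha) (hdet : Ha.det ≠ 0) (x : ↥(quatAdelicUnits L Ha))
    (a : Fin 4 → AdeleRing (𝓞 ↥(maximalRealSubfield L)) ↥(maximalRealSubfield L)) :
    quatCoord L (fun i => ((quatBasis L Ha hHa hdet i : ↥(quatRatSubalgebra L Ha)) : Matrix (Fin 2) (Fin 2) L))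
        (quatCoordInv L hHa hdet (((x : GL (Fin 2) (AdeleRing (𝓞 L) L)) : Matrix (Fin 2) (Fin 2) (AdeleRing (𝓞 L) L)) *
          quatCoord L (fun i => ((quatBasis L Ha hHa hdet i : ↥(quatRatSubalgebra L Ha)) : Matrix (Fin 2) (Fin 2) L)) a)) =
      ((x : GL (Fin 2) (AdeleRing (𝓞 L) L)) : Matrix (Fin 2) (Fin 2) (AdeleRing (𝓞 L) L)) *
        quatCoord L (fun i => ((quatBasis L Ha hHa hdet i : ↥(quatRatSubalgebra L Ha)) : Matrix (Fin 2) (Fin 2) L)) a :=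
  quatCoord_quatCoordInv L hHa hdet
    ((quatAdelic L Ha).mul_mem (coe_coe_mem_quatAdelic L x) (quatCoord_mem_quatAdelic L Ha (coe_quatBasis_mem L Ha hHa hdet) a))

/-- `T_{x⁻¹} (T_x a) = a`. [cite: VignerasLNM800, Ch. III §1] -/
theorem dilate_inv_dilate (hHa : (Ha.map (cmConjRingHom L)).transpose = Ha) (hdet : Ha.det ≠ 0) (x : ↥(quatAdelicUnits L Ha))
    (a : Fin 4 → AdeleRing (𝓞 ↥(maximalRealSubfield L)) ↥(maximalRealSubfield L)) :
    quatCoordInv L hHa hdet (((x⁻¹ : ↥(quatAdelicUnits L Ha)) : GL (Fin 2) (AdeleRing (𝓞 L) L)) *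
        quatCoord L (fun i => ((quatBasis L Ha hHa hdet i : ↥(quatRatSubalgebra L Ha)) : Matrix (Fin 2) (Fin 2) L))
          (quatCoordInv L hHa hdet (((x : GL (Fin 2) (AdeleRing (𝓞 L) L)) : Matrix (Fin 2) (Fin 2) (AdeleRing (𝓞 L) L)) *
            quatCoord L (fun i => ((quatBasis L Ha hHa hdet i : ↥(quatRatSubalgebra L Ha)) : Matrix (Fin 2) (Fin 2) L)) a))) = a := by
  rw [quatCoord_dilate, ← Matrix.mul_assoc, Subgroup.coe_inv, Units.inv_mul, Matrix.one_mul, quatCoordInv_quatCoord]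

/-- `T_x (T_{x⁻¹} a) = a`. [cite: VignerasLNM800, Ch. III §1] -/
theorem dilate_dilate_inv (hHa : (Ha.map (cmConjRingHom L)).transpose = Ha) (hdet : Ha.det ≠ 0) (x : ↥(quatAdelicUnits L Ha))
    (a : Fin 4 → AdeleRing (𝓞 ↥(maximalRealSubfield L)) ↥(maximalRealSubfield L)) :
    quatCoordInv L hHa hdet (((x : GL (Fin 2) (AdeleRing (𝓞 L) L)) : Matrix (Fin 2) (Fin 2) (AdeleRing (𝓞 L) L)) *
        quatCoord L (fun i => ((quatBasis L Ha hHa hdet i : ↥(quatRatSubalgebra L Ha)) : Matrix (Fin 2) (Fin 2) L))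
          (quatCoordInv L hHa hdet (((x⁻¹ : ↥(quatAdelicUnits L Ha)) : GL (Fin 2) (AdeleRing (𝓞 L) L)) *
            quatCoord L (fun i => ((quatBasis L Ha hHa hdet i : ↥(quatRatSubalgebra L Ha)) : Matrix (Fin 2) (Fin 2) L)) a))) = a := by
  have h := dilate_inv_dilate L hHa hdet x⁻¹ a
  rwa [inv_inv] at h

/-- `T_x` is continuous (★ `continuous_quatCoord`, ★ `continuous_quatCoordInv`, matrix multiplication). [cite: VignerasLNM800, Ch. III §1] -/
theorem continuous_dilate (hHa : (Ha.map (cmConjRingHom L)).transpose = Ha) (hdet : Ha.det ≠ 0) (x : ↥(quatAdelicUnits L Ha)) :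
    Continuous fun a : Fin 4 → AdeleRing (𝓞 ↥(maximalRealSubfield L)) ↥(maximalRealSubfield L) =>
      quatCoordInv L hHa hdet (((x : GL (Fin 2) (AdeleRing (𝓞 L) L)) : Matrix (Fin 2) (Fin 2) (AdeleRing (𝓞 L) L)) *
        quatCoord L (fun i => ((quatBasis L Ha hHa hdet i : ↥(quatRatSubalgebra L Ha)) : Matrix (Fin 2) (Fin 2) L)) a) :=
  (continuous_quatCoordInv L hHa hdet).comp (continuous_const.matrix_mul (continuous_quatCoord L _))

/-! ## §2 The module of `T_x` is `|det x|_{𝔸_L}` («doubling» through `M₂(𝔸_L) = D_{h,𝔸} ⊕ μ·D_{h,𝔸}`) -/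

section Module

variable [MeasurableSpace (AdeleRing (𝓞 ↥(maximalRealSubfield L)) ↥(maximalRealSubfield L))]
  [BorelSpace (AdeleRing (𝓞 ↥(maximalRealSubfield L)) ↥(maximalRealSubfield L))]
  (ν4 : Measure (Fin 4 → AdeleRing (𝓞 ↥(maximalRealSubfield L)) ↥(maximalRealSubfield L))) [ν4.IsAddHaarMeasure]

/-- **THE MODULE OF LEFT MULTIPLICATION: `ν4 (T_x '' S) = |det x|_{𝔸_L} · ν4 S`** for every unit `x ∈ (D_h ⊗ 𝔸)^×`, every additive Haar measure `ν4` on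
`𝔸⁺⁴` and EVERY set `S` — the module of `y ↦ x y` on `D_{h,𝔸} ≅ 𝔸⁺⁴` is ★ `quatModule L Ha x`.  Proof by doubling: `Θ(a, b) = ∑ᵢ Ψ(aᵢ, bᵢ)·(eᵢ ⊗ 1)` is an
equivariant additive homeomorphism `𝔸⁺⁴ × 𝔸⁺⁴ ≃ M₂(𝔸_L)` (`x · Θ(a,b) = Θ(T_x a, T_x b)`), so ★ `addHaar_matrix_smul_eq` (module `|det x|²` on `M₂(𝔸_L)`) for the
Haar measure `Θ_*(ν4 ⊗ ν4)` gives `ν4(T_x A)·ν4(T_x A') = |det x|²·ν4(A)·ν4(A')`, whence the claim (take `A = A'` a positive compact first).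
[cite: WeilBNT1967, Ch. IV §3 Prop. 3, Cor. 1; Ch. I §2] [cite: VignerasLNM800, Ch. III §2 (proof of Thm. 2.2)] -/
theorem measure_image_dilate (hHa : (Ha.map (cmConjRingHom L)).transpose = Ha) (hdet : Ha.det ≠ 0) (x : ↥(quatAdelicUnits L Ha))
    (S : Set (Fin 4 → AdeleRing (𝓞 ↥(maximalRealSubfield L)) ↥(maximalRealSubfield L))) :
    ν4 ((fun a => quatCoordInv L hHa hdet (((x : GL (Fin 2) (AdeleRing (𝓞 L) L)) : Matrix (Fin 2) (Fin 2) (AdeleRing (𝓞 L) L)) *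
        quatCoord L (fun i => ((quatBasis L Ha hHa hdet i : ↥(quatRatSubalgebra L Ha)) : Matrix (Fin 2) (Fin 2) L)) a)) '' S) =
      ((quatModule L Ha x : ℝ≥0) : ℝ≥0∞) * ν4 S := by
  classical
  -- ambient instances
  haveI := locallyCompactSpace_adeleRing' L
  haveI := secondCountableTopology_adeleRing L
  haveI := t2Space_adeleRing L
  haveI := locallyCompactSpace_adeleRing' (↥(maximalRealSubfield L))
  haveI := secondCountableTopology_adeleRing (↥(maximalRealSubfield L))
  haveI := t2Space_adeleRing (↥(maximalRealSubfield L))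
  haveI : LocallyCompactSpace (Matrix (Fin 2) (Fin 2) (AdeleRing (𝓞 L) L)) :=
    inferInstanceAs (LocallyCompactSpace (Fin 2 → Fin 2 → AdeleRing (𝓞 L) L))
  haveI : SecondCountableTopology (Matrix (Fin 2) (Fin 2) (AdeleRing (𝓞 L) L)) :=
    inferInstanceAs (SecondCountableTopology (Fin 2 → Fin 2 → AdeleRing (𝓞 L) L))
  letI : MeasurableSpace (Matrix (Fin 2) (Fin 2) (AdeleRing (𝓞 L) L)) := borel _
  haveI : BorelSpace (Matrix (Fin 2) (Fin 2) (AdeleRing (𝓞 L) L)) := ⟨rfl⟩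
  -- notation
  set e : Fin 4 → Matrix (Fin 2) (Fin 2) L := fun i => ((quatBasis L Ha hHa hdet i : ↥(quatRatSubalgebra L Ha)) : Matrix (Fin 2) (Fin 2) L) with he
  set B := quatBasisAdele L hHa hdet with hB
  set Ψ := UnitaryGroup.quadraticAdeleEquiv (↥(maximalRealSubfield L)) L (IsCMField.complexConj L) (complexConj_skewElt L) (skewElt_ne_zero L) with hΨ
  set xM : Matrix (Fin 2) (Fin 2) (AdeleRing (𝓞 L) L) := ((x : GL (Fin 2) (AdeleRing (𝓞 L) L)) : Matrix (Fin 2) (Fin 2) (AdeleRing (𝓞 L) L)) with hxM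
  set T : (Fin 4 → AdeleRing (𝓞 ↥(maximalRealSubfield L)) ↥(maximalRealSubfield L)) →
      (Fin 4 → AdeleRing (𝓞 ↥(maximalRealSubfield L)) ↥(maximalRealSubfield L)) :=
    fun a => quatCoordInv L hHa hdet (xM * quatCoord L e a) with hT
  have hTco : ∀ a, quatCoord L e (T a) = xM * quatCoord L e a := fun a => quatCoord_dilate L hHa hdet x a
  -- continuity of the coordinate functionals of `B` (as in ★ `continuous_quatCoordInv`)
  have hcoord : Continuous fun X : Matrix (Fin 2) (Fin 2) (AdeleRing (𝓞 L) L) => (B.equivFun X : Fin 4 → AdeleRing (𝓞 L) L) := by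
    let unc : (Fin 2 × Fin 2 → AdeleRing (𝓞 L) L) →ₗ[AdeleRing (𝓞 L) L] Matrix (Fin 2) (Fin 2) (AdeleRing (𝓞 L) L) :=
      { toFun := fun v => Matrix.of fun j k => v (j, k)
        map_add' := fun _ _ => rfl
        map_smul' := fun _ _ => rfl }
    have h1 : Continuous (B.equivFun.toLinearMap.comp unc) := LinearMap.continuous_on_pi _
    have h2 : Continuous fun X : Matrix (Fin 2) (Fin 2) (AdeleRing (𝓞 L) L) => (fun p : Fin 2 × Fin 2 => X p.1 p.2) :=
      continuous_pi fun p => (continuous_apply p.2).comp (continuous_apply p.1)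
    convert h1.comp h2 using 1
    funext X
    rfl
  -- the doubling homeomorphism `Θ`
  let Θ : (Fin 4 → AdeleRing (𝓞 ↥(maximalRealSubfield L)) ↥(maximalRealSubfield L)) ×
      (Fin 4 → AdeleRing (𝓞 ↥(maximalRealSubfield L)) ↥(maximalRealSubfield L)) ≃ₜ Matrix (Fin 2) (Fin 2) (AdeleRing (𝓞 L) L) :=
    { toFun := fun p => B.equivFun.symm fun i => Ψ (p.1 i, p.2 i)
      invFun := fun X => (fun i => (Ψ.symm (B.equivFun X i)).1, fun i => (Ψ.symm (B.equivFun X i)).2)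
      left_inv := fun p => by
        ext i
        · simp only [LinearEquiv.apply_symm_apply, ContinuousAddEquiv.symm_apply_apply]
        · simp only [LinearEquiv.apply_symm_apply, ContinuousAddEquiv.symm_apply_apply]
      right_inv := fun X => by
        simp only [Prod.mk.eta, ContinuousAddEquiv.apply_symm_apply]
        exact B.equivFun.symm_apply_apply X
      continuous_toFun := by
        simp only [Module.Basis.equivFun_symm_apply]
        refine continuous_finsetSum _ fun i _ => ?_
        exact ((map_continuous Ψ).comp (((continuous_apply i).comp continuous_fst).prodMk
          ((continuous_apply i).comp continuous_snd))).smul continuous_const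
      continuous_invFun := by
        exact (continuous_pi fun i => continuous_fst.comp ((map_continuous Ψ.symm).comp ((continuous_apply i).comp hcoord))).prodMk
          (continuous_pi fun i => continuous_snd.comp ((map_continuous Ψ.symm).comp ((continuous_apply i).comp hcoord))) }
  -- the formula `Θ(a, b) = quatCoord e a + μ • quatCoord e b`
  have hΘ : ∀ p : (Fin 4 → AdeleRing (𝓞 ↥(maximalRealSubfield L)) ↥(maximalRealSubfield L)) ×
      (Fin 4 → AdeleRing (𝓞 ↥(maximalRealSubfield L)) ↥(maximalRealSubfield L)),
      Θ p = quatCoord L e p.1 + algebraMap L (AdeleRing (𝓞 L) L) (skewElt L) • quatCoord L e p.2 := by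
    intro p
    change B.equivFun.symm (fun i => Ψ (p.1 i, p.2 i)) = _
    rw [Module.Basis.equivFun_symm_apply, quatCoord_eq_sum_quatBasisAdele, quatCoord_eq_sum_quatBasisAdele, Finset.smul_sum,
      ← Finset.sum_add_distrib]
    refine Finset.sum_congr rfl fun i _ => ?_
    rw [hΨ, UnitaryGroup.quadraticAdeleEquiv_apply, add_smul, smul_smul, mul_comm]
  -- `Θ` is additive
  have hΘadd : ∀ p q, Θ (p + q) = Θ p + Θ q := by
    intro p q
    rw [hΘ, hΘ, hΘ, Prod.fst_add, Prod.snd_add, map_add, map_add, smul_add]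
    abel
  -- equivariance: `x · Θ(a, b) = Θ(T a, T b)`
  have hΘT : ∀ p : (Fin 4 → AdeleRing (𝓞 ↥(maximalRealSubfield L)) ↥(maximalRealSubfield L)) ×
      (Fin 4 → AdeleRing (𝓞 ↥(maximalRealSubfield L)) ↥(maximalRealSubfield L)),
      xM * Θ p = Θ (T p.1, T p.2) := by
    intro p
    rw [hΘ, hΘ, Matrix.mul_add, Matrix.mul_smul, hTco, hTco]
  -- the Haar measure `λ_V = Θ_*(ν4 ⊗ ν4)` on `M₂(𝔸_L)`
  let ΘA : ((Fin 4 → AdeleRing (𝓞 ↥(maximalRealSubfield L)) ↥(maximalRealSubfield L)) ×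
      (Fin 4 → AdeleRing (𝓞 ↥(maximalRealSubfield L)) ↥(maximalRealSubfield L))) ≃+ Matrix (Fin 2) (Fin 2) (AdeleRing (𝓞 L) L) :=
    { Θ.toEquiv with map_add' := hΘadd }
  set lam : Measure (Matrix (Fin 2) (Fin 2) (AdeleRing (𝓞 L) L)) := Measure.map Θ (ν4.prod ν4) with hlam
  haveI : lam.IsAddHaarMeasure := by
    have h := AddEquiv.isAddHaarMeasure_map (ν4.prod ν4) ΘA Θ.continuous Θ.symm.continuous
    exact h
  haveI : lam.Regular := inferInstance
  -- measures of doubled boxes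
  have hbox : ∀ A A' : Set (Fin 4 → AdeleRing (𝓞 ↥(maximalRealSubfield L)) ↥(maximalRealSubfield L)),
      lam (Θ '' (A ×ˢ A')) = ν4 A * ν4 A' := by
    intro A A'
    rw [hlam, ← Homeomorph.toMeasurableEquiv_coe, MeasurableEquiv.map_apply, Homeomorph.toMeasurableEquiv_coe,
      Θ.injective.preimage_image, Measure.prod_prod]
  -- the module identity on `M₂(𝔸_L)` (★), read on doubled boxes
  have hmod : ∀ A A' : Set (Fin 4 → AdeleRing (𝓞 ↥(maximalRealSubfield L)) ↥(maximalRealSubfield L)),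
      ν4 (T '' A) * ν4 (T '' A') = ((adelicAbsDet 2 L (x : GL (Fin 2) (AdeleRing (𝓞 L) L)) ^ 2 : ℝ≥0) : ℝ≥0∞) * (ν4 A * ν4 A') := by
    intro A A'
    have hset : (x : GL (Fin 2) (AdeleRing (𝓞 L) L)) • (Θ '' (A ×ˢ A')) = Θ '' ((T '' A) ×ˢ (T '' A')) := by
      rw [← Set.prodMap_image_prod, Set.image_image, ← Set.image_smul, Set.image_image]
      refine Set.image_congr fun p _ => ?_
      rw [Units.smul_def, smul_eq_mul]
      exact hΘT p
    rw [← hbox, ← hbox, ← hset, addHaar_matrix_smul_eq 2 L lam]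
  -- a positive compact
  obtain ⟨K₀⟩ := (inferInstance : Nonempty (TopologicalSpace.PositiveCompacts
    (Fin 4 → AdeleRing (𝓞 ↥(maximalRealSubfield L)) ↥(maximalRealSubfield L))))
  have hK0 : ν4 (K₀ : Set _) ≠ 0 := (measure_pos_of_nonempty_interior ν4 K₀.interior_nonempty).ne'
  have hKtop : ν4 (K₀ : Set _) ≠ ∞ := K₀.isCompact.measure_lt_top.ne
  set d : ℝ≥0∞ := ((adelicAbsDet 2 L (x : GL (Fin 2) (AdeleRing (𝓞 L) L)) : ℝ≥0) : ℝ≥0∞) with hd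
  have hd0 : d ≠ 0 := by
    rw [hd, ENNReal.coe_ne_zero]
    exact (NNReal.coe_pos.1 (adelicAbsDet_pos (x : GL (Fin 2) (AdeleRing (𝓞 L) L)))).ne'
  have hdtop : d ≠ ∞ := ENNReal.coe_ne_top
  -- first `A = A' = K₀`: `ν4 (T K₀) = d · ν4 K₀`
  have hK : ν4 (T '' (K₀ : Set _)) = d * ν4 (K₀ : Set _) := by
    have h := hmod K₀ K₀
    rw [ENNReal.coe_pow, ← hd, ← pow_two, ← pow_two, ← mul_pow] at h
    exact (ENNReal.pow_right_strictMono two_ne_zero).injective h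
  -- then the general set
  have hgen : ν4 (T '' S) * (d * ν4 (K₀ : Set _)) = (d * ν4 S) * (d * ν4 (K₀ : Set _)) := by
    have h := hmod S K₀
    rw [ENNReal.coe_pow, ← hd, hK] at h
    calc ν4 (T '' S) * (d * ν4 (K₀ : Set _)) = d ^ 2 * (ν4 S * ν4 (K₀ : Set _)) := h
      _ = (d * ν4 S) * (d * ν4 (K₀ : Set _)) := by ring
  have hcancel := (ENNReal.mul_left_inj (mul_ne_zero hd0 hK0) (ENNReal.mul_ne_top hdtop hKtop)).1 hgen
  rw [hcancel]
  rfl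

/-! ## §3 Change of variables `∫ Φ(x · y) dy = |det x|⁻¹ ∫ Φ` -/

/-- **`(T_x)_* ν4 = |det x|_{𝔸_L}⁻¹ • ν4`**: the image of an additive Haar measure of `𝔸⁺⁴` under the coordinate dilation is the same measure divided by the
module (`measure_image_dilate` applied to `T_{x⁻¹} = T_x⁻¹`). [cite: WeilBNT1967, Ch. I §2] [cite: VignerasLNM800, Ch. III §2] -/
theorem map_dilate_eq_smul (hHa : (Ha.map (cmConjRingHom L)).transpose = Ha) (hdet : Ha.det ≠ 0) (x : ↥(quatAdelicUnits L Ha)) :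
    Measure.map (fun a => quatCoordInv L hHa hdet (((x : GL (Fin 2) (AdeleRing (𝓞 L) L)) : Matrix (Fin 2) (Fin 2) (AdeleRing (𝓞 L) L)) *
        quatCoord L (fun i => ((quatBasis L Ha hHa hdet i : ↥(quatRatSubalgebra L Ha)) : Matrix (Fin 2) (Fin 2) L)) a)) ν4 =
      ((quatModule L Ha x⁻¹ : ℝ≥0) : ℝ≥0∞) • ν4 := by
  haveI := secondCountableTopology_adeleRing (↥(maximalRealSubfield L))
  -- `T_x` as a homeomorphism with inverse `T_{x⁻¹}`
  let Th : (Fin 4 → AdeleRing (𝓞 ↥(maximalRealSubfield L)) ↥(maximalRealSubfield L)) ≃ₜ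
      (Fin 4 → AdeleRing (𝓞 ↥(maximalRealSubfield L)) ↥(maximalRealSubfield L)) :=
    { toFun := fun a => quatCoordInv L hHa hdet (((x : GL (Fin 2) (AdeleRing (𝓞 L) L)) : Matrix (Fin 2) (Fin 2) (AdeleRing (𝓞 L) L)) *
        quatCoord L (fun i => ((quatBasis L Ha hHa hdet i : ↥(quatRatSubalgebra L Ha)) : Matrix (Fin 2) (Fin 2) L)) a)
      invFun := fun a => quatCoordInv L hHa hdet (((x⁻¹ : ↥(quatAdelicUnits L Ha)) : GL (Fin 2) (AdeleRing (𝓞 L) L)) *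
        quatCoord L (fun i => ((quatBasis L Ha hHa hdet i : ↥(quatRatSubalgebra L Ha)) : Matrix (Fin 2) (Fin 2) L)) a)
      left_inv := fun a => dilate_inv_dilate L hHa hdet x a
      right_inv := fun a => dilate_dilate_inv L hHa hdet x a
      continuous_toFun := continuous_dilate L hHa hdet x
      continuous_invFun := continuous_dilate L hHa hdet x⁻¹ }
  refine Measure.ext fun s hs => ?_
  rw [show (fun a => quatCoordInv L hHa hdet (((x : GL (Fin 2) (AdeleRing (𝓞 L) L)) : Matrix (Fin 2) (Fin 2) (AdeleRing (𝓞 L) L)) *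
        quatCoord L (fun i => ((quatBasis L Ha hHa hdet i : ↥(quatRatSubalgebra L Ha)) : Matrix (Fin 2) (Fin 2) L)) a)) = (Th : _ → _) from rfl,
    ← Homeomorph.toMeasurableEquiv_coe, MeasurableEquiv.map_apply, Homeomorph.toMeasurableEquiv_coe, Measure.smul_apply, smul_eq_mul,
    ← Homeomorph.image_symm]
  exact measure_image_dilate L ν4 hHa hdet x⁻¹ s

/-- **CHANGE OF VARIABLES `y ↦ x·y` ON `D_{h,𝔸}` (coordinate form): `∫ Φ(x · quatCoord e a) dν4(a) = |det x|_{𝔸_L}⁻¹ • ∫ Φ(quatCoord e a) dν4(a)`** for EVERY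
unit `x ∈ (D_h ⊗ 𝔸)^×`, every additive Haar measure `ν4` on `𝔸⁺⁴` and every `Φ : M₂(𝔸_L) → E` (Bochner; no measurability needed since `T_x` is a
measurable equivalence) — the substitution that carries Tate's unfolding of the zeta integral of `D_h` (`|det x|_{𝔸_L} = quatModule x`, the module of
`D_{h,𝔸}`). [cite: VignerasLNM800, Ch. III §2 (proof of Thm. 2.2)] [cite: WeilBNT1967, Ch. I §2; Ch. IV §3 Cor. 1] -/
theorem integral_quatCoord_mul_left {E : Type*} [NormedAddCommGroup E] [NormedSpace ℝ E]
    (hHa : (Ha.map (cmConjRingHom L)).transpose = Ha) (hdet : Ha.det ≠ 0) (x : ↥(quatAdelicUnits L Ha))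
    (Φ : Matrix (Fin 2) (Fin 2) (AdeleRing (𝓞 L) L) → E) :
    ∫ a, Φ (((x : GL (Fin 2) (AdeleRing (𝓞 L) L)) : Matrix (Fin 2) (Fin 2) (AdeleRing (𝓞 L) L)) *
        quatCoord L (fun i => ((quatBasis L Ha hHa hdet i : ↥(quatRatSubalgebra L Ha)) : Matrix (Fin 2) (Fin 2) L)) a) ∂ν4 =
      ((quatModule L Ha x⁻¹ : ℝ≥0) : ℝ) •
        ∫ a, Φ (quatCoord L (fun i => ((quatBasis L Ha hHa hdet i : ↥(quatRatSubalgebra L Ha)) : Matrix (Fin 2) (Fin 2) L)) a) ∂ν4 := by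
  haveI := secondCountableTopology_adeleRing (↥(maximalRealSubfield L))
  let Th : (Fin 4 → AdeleRing (𝓞 ↥(maximalRealSubfield L)) ↥(maximalRealSubfield L)) ≃ₜ
      (Fin 4 → AdeleRing (𝓞 ↥(maximalRealSubfield L)) ↥(maximalRealSubfield L)) :=
    { toFun := fun a => quatCoordInv L hHa hdet (((x : GL (Fin 2) (AdeleRing (𝓞 L) L)) : Matrix (Fin 2) (Fin 2) (AdeleRing (𝓞 L) L)) *
        quatCoord L (fun i => ((quatBasis L Ha hHa hdet i : ↥(quatRatSubalgebra L Ha)) : Matrix (Fin 2) (Fin 2) L)) a)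
      invFun := fun a => quatCoordInv L hHa hdet (((x⁻¹ : ↥(quatAdelicUnits L Ha)) : GL (Fin 2) (AdeleRing (𝓞 L) L)) *
        quatCoord L (fun i => ((quatBasis L Ha hHa hdet i : ↥(quatRatSubalgebra L Ha)) : Matrix (Fin 2) (Fin 2) L)) a)
      left_inv := fun a => dilate_inv_dilate L hHa hdet x a
      right_inv := fun a => dilate_dilate_inv L hHa hdet x a
      continuous_toFun := continuous_dilate L hHa hdet x
      continuous_invFun := continuous_dilate L hHa hdet x⁻¹ }
  have hcomp : (fun a => Φ (((x : GL (Fin 2) (AdeleRing (𝓞 L) L)) : Matrix (Fin 2) (Fin 2) (AdeleRing (𝓞 L) L)) *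
        quatCoord L (fun i => ((quatBasis L Ha hHa hdet i : ↥(quatRatSubalgebra L Ha)) : Matrix (Fin 2) (Fin 2) L)) a)) =
      (fun b => Φ (quatCoord L (fun i => ((quatBasis L Ha hHa hdet i : ↥(quatRatSubalgebra L Ha)) : Matrix (Fin 2) (Fin 2) L)) b)) ∘ Th := by
    funext a
    simp only [Function.comp_apply]
    rw [show (Th a) = quatCoordInv L hHa hdet (((x : GL (Fin 2) (AdeleRing (𝓞 L) L)) : Matrix (Fin 2) (Fin 2) (AdeleRing (𝓞 L) L)) *
        quatCoord L (fun i => ((quatBasis L Ha hHa hdet i : ↥(quatRatSubalgebra L Ha)) : Matrix (Fin 2) (Fin 2) L)) a) from rfl,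
      quatCoord_dilate]
  have hmap := Th.toMeasurableEquiv.measurableEmbedding.integral_map (μ := ν4)
    (fun b => Φ (quatCoord L (fun i => ((quatBasis L Ha hHa hdet i : ↥(quatRatSubalgebra L Ha)) : Matrix (Fin 2) (Fin 2) L)) b))
  rw [Homeomorph.toMeasurableEquiv_coe] at hmap
  rw [hcomp]
  change ∫ a, Φ (quatCoord L (fun i => ((quatBasis L Ha hHa hdet i : ↥(quatRatSubalgebra L Ha)) : Matrix (Fin 2) (Fin 2) L)) (Th a)) ∂ν4 = _
  rw [← hmap,
    show (Th : _ → _) = (fun a => quatCoordInv L hHa hdet (((x : GL (Fin 2) (AdeleRing (𝓞 L) L)) : Matrix (Fin 2) (Fin 2) (AdeleRing (𝓞 L) L)) *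
        quatCoord L (fun i => ((quatBasis L Ha hHa hdet i : ↥(quatRatSubalgebra L Ha)) : Matrix (Fin 2) (Fin 2) L)) a)) from rfl,
    map_dilate_eq_smul L ν4 hHa hdet x, integral_smul_measure, ENNReal.coe_toReal]

end Module

end Summit.HodgeConjecture.HodgeConjecture.Cruxes.H413.K2E5QuatPoissonDilation

end
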